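import Summits.BirchSwinnertonDyer.Rank1Residual.GaloisImage.EulerFactorComparisonDerivative
import Summits.BirchSwinnertonDyer.Rank1Residual.GaloisImage.EulerFactorFamilies
import Summits.BirchSwinnertonDyer.Rank1Residual.GaloisImage.GroupRingPrimitiveProjector
import HarnessLib

/-!
# The derivative comparison in a group ring: two elements generated from one primitive datum with
# alternate Euler factors have an explicitly divisible derivative difference
# (cell `b2b-bsdres`, team n1011, ROUTE-1 PORT anatomy (P-KIM); R1-71/R1-72: PK-4b
# `KatoZetaValueDerivativeCongruence`, layer PK-4b-C3; seat p15 GEN 9)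

HONEST FRAMING (cell `b2b-bsdres`, run/shared/lean/b2b/bsd-rank1-residual/, verbatim in every
file): the goal of the cell is to DELETE the COMBINATION-SHAPED residual classes of the
Birch–Swinnerton-Dyer formula for ALL analytic-rank `≤ 1` elliptic curves over `ℚ` — "full BSD
formula for every rank `≤ 1` curve in class `C`" assembled STRICTLY from published theorems — so
that the rank-`≤ 1` remainder becomes exactly the CONSTRUCTION-SHAPED classes, which are TYPED
(missing-input `Prop`s), NOT attempted. This is not "finishing BSD". Team n1011 (N10/N11; ROUTE 1,
the PORT anatomy (P-KIM) of class X4 ∧ `p = 3`): research route on CONSTRUCTION-SHAPED classes;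
prove what is provable now; no claim beyond stated classes; census output = EVIDENCE, never a
Literature fact; RESIDUAL-MAP marks UNCHANGED; nothing is booked by this file. TOOL THEOREMS ONLY:
no definition, no named fact, no instance, no `sorry`.

## What

The group-ring instantiation of PK-4b-A (`EulerFactorComparisonDerivative`) + PK-4b-C2
(`EulerFactorFamilies`). Setting: a finite commutative group `G` (the application: `(ℤ/n)ˣ`, `n` a
Kolyvagin level), a commutative coefficient ring `A` (the application: `ℂ`, where the character
components live), indices `ι` (a FINITE type: the primes of `n`; levels are ALL `d : Finset ι`, the
top level is `univ`), subgroups `H_i ≤ G` (the inertia factors `G_{ℓ_i}`) with norm elements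
`N_i = Σ_{h∈H_i} δ_h`, elements `b_i ∈ H_i` carrying the "derivatives" `D_i = Σ_{j<ν_i} j·δ_{b_i^j}`,
scalars `w_i` inverting `#H_i` in `A`, projectors `e_i = w_i N_i`, and the scalars
`g_i = w_i · Σ_{j<ν_i} j` (`= (ν_i − 1)/2` when `ν_i = #H_i`). For local factors `K_i`, `M_i` and ONE
datum `B ∈ A[G]`, if
* `X = (∏_i (e_i K_i + (1 − e_i))) · B`                         (`hX`: "Kato-shaped components"), and
* `Y d = (∏_{j∉d} N_j) · (∏_{i∈d} (e_i M_i + (1 − e_i))) · B` for every `d` (`hY`: the modular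
  pull-backs, "Mazur–Tate-shaped components"),
then (`prod_deriv_mul_sub_eq_sum_of_generated`)
`(∏_i D_i) · (X − Y univ) = Σ_{∅≠U} (∏_{i∈U} g_i) · (∏_{i∉U} D̃_i) · ((∏_{i∈U} K_i − ∏_{i∈U} M_i) · Y (univ∖U))`,
`D̃_i = D_i − g_i N_i`: the hypotheses (P) and (L′) of PK-4b-A hold identically for generated families
(PK-4b-C2), with the synthetic lower-level Kato family `(∏_{j∉d} N_j)(∏_{i∈d}(e_i K_i + 1 − e_i)) B`.
The right-hand side never mentions `X` or `B`: it is built from the modular pull-backs `Y d`, `d ≠ univ`,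
the norms and derivatives, and the Euler-factor differences — so (`image_sub_mem_of_generated`) as soon
as those are images of INTEGRAL elements and every `K_i − M_i` is the image of an element of an ideal
`𝔞` (the application: `(1 − ℓ_i)σ ∈ 3^{k+1}ℤ₍₃₎[G]`), the difference `(∏ D_i)X − (∏ D_i)(Y univ)` lies in
the image of `𝔞` — WITHOUT any integrality of `X` (Kato's `ZetaBody` carries none).
HONEST LIMITS: pure algebra in `A[G]`; no character, no `(ℤ/n)ˣ`, no Kato object; the identification
of Kato's avatar and of the Mazur–Tate pull-backs with generated families (by character components,
PK-4a / F-C) is PK-4b-C4; closes nothing.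

References: K. Rubin, *Euler Systems* (2000) §9.6 and §4.4; r1 ROUTE-1 §55–57 R1-71/R1-72
(cells/n1011/ROUTE-1.md).
-/

noncomputable section

namespace Summit.BirchSwinnertonDyer.Rank1Residual.GaloisImage

namespace EulerFactorComparison

open Finset MonoidAlgebra
open scoped BigOperators

variable {A : Type*} [CommRing A] {G : Type*} [CommGroup G] [Fintype G]
variable {ι : Type*} [Fintype ι] [DecidableEq ι]
variable (H : ι → Subgroup G) [∀ i, DecidablePred (· ∈ H i)] (b : ι → G) (ν : ι → ℕ) (w : ι → A)
variable (N D e g K M : ι → MonoidAlgebra A G) (B X : MonoidAlgebra A G)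
  (Y : Finset ι → MonoidAlgebra A G)

/-! ### §1 The relations `hNN`, `hDN`, `hg`, `hν` and the projectors in `A[G]` -/

omit [Fintype ι] [DecidableEq ι] in
/-- `N_i N_i = #H_i · N_i`. [folklore] -/
theorem norm_mul_norm_eq (hN : ∀ i, N i = ∑ h ∈ univ.filter (· ∈ H i), single h (1 : A)) (i : ι) :
    N i * N i = ((((univ.filter (· ∈ H i)).card : ℕ) : MonoidAlgebra A G)) * N i := by
  rw [hN i]
  exact sum_single_subgroup_mul_self (H i)

omit [Fintype ι] [DecidableEq ι] in
/-- `D_i N_i = (Σ_{j<ν_i} j) · N_i` for `b_i ∈ H_i`. [folklore] -/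
theorem deriv_mul_norm_eq (hN : ∀ i, N i = ∑ h ∈ univ.filter (· ∈ H i), single h (1 : A))
    (hD : ∀ i, D i = ∑ j ∈ range (ν i), single (b i ^ j) ((j : ℕ) : A)) (hb : ∀ i, b i ∈ H i)
    (i : ι) :
    D i * N i = (((∑ j ∈ range (ν i), j : ℕ)) : MonoidAlgebra A G) * N i := by
  rw [hN i, hD i]
  exact deriv_mul_sum_single_subgroup (H i) (hb i) (ν i)

omit [Fintype ι] [DecidableEq ι] in
/-- `g_i · #H_i = Σ_{j<ν_i} j` for `g_i = (w_i Σ_{j<ν_i} j) · 1`, `w_i #H_i = 1`. [folklore] -/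
theorem g_mul_card_eq (hw : ∀ i, w i * (((univ.filter (· ∈ H i)).card : ℕ) : A) = 1)
    (hg : ∀ i, g i = (w i * (((∑ j ∈ range (ν i), j : ℕ)) : A)) • (1 : MonoidAlgebra A G)) (i : ι) :
    g i * ((((univ.filter (· ∈ H i)).card : ℕ) : MonoidAlgebra A G)) =
      (((∑ j ∈ range (ν i), j : ℕ)) : MonoidAlgebra A G) := by
  rw [hg i, smul_mul_assoc, one_mul, ← map_natCast (algebraMap A (MonoidAlgebra A G)),
    ← map_natCast (algebraMap A (MonoidAlgebra A G)) (∑ j ∈ range (ν i), j), Algebra.smul_def,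
    ← map_mul, mul_assoc, mul_comm (((∑ j ∈ range (ν i), j : ℕ) : A)), ← mul_assoc, hw i, one_mul]

omit [Fintype ι] [DecidableEq ι] in
/-- `#H_i` is a unit of `A[G]` when `w_i` inverts it in `A`. [folklore] -/
theorem isUnit_card (hw : ∀ i, w i * (((univ.filter (· ∈ H i)).card : ℕ) : A) = 1) (i : ι) :
    IsUnit ((((univ.filter (· ∈ H i)).card : ℕ) : MonoidAlgebra A G)) := by
  rw [← map_natCast (algebraMap A (MonoidAlgebra A G))]
  exact (IsUnit.of_mul_eq_one _ (by rw [mul_comm]; exact hw i)).map _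

omit [Fintype ι] [DecidableEq ι] in
/-- The projectors `e_i = w_i N_i`: `N_i e_i = N_i` and `(#H_i − N_i) e_i = 0`. [folklore] -/
theorem proj_relations (hN : ∀ i, N i = ∑ h ∈ univ.filter (· ∈ H i), single h (1 : A))
    (hw : ∀ i, w i * (((univ.filter (· ∈ H i)).card : ℕ) : A) = 1) (he : ∀ i, e i = w i • N i) :
    (∀ i, N i * e i = N i) ∧
      ∀ i, (((((univ.filter (· ∈ H i)).card : ℕ) : MonoidAlgebra A G)) - N i) * e i = 0 := by
  have h := proj_of_norm N (fun i => (((univ.filter (· ∈ H i)).card : ℕ) : MonoidAlgebra A G))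
    (fun i => algebraMap A (MonoidAlgebra A G) (w i))
    (fun i => by rw [hN i]; exact sum_single_subgroup_mul_self (H i))
    (fun i => by
      rw [← map_natCast (algebraMap A (MonoidAlgebra A G)), ← map_mul, hw i, map_one])
  have he' : ∀ i, e i = algebraMap A (MonoidAlgebra A G) (w i) * N i := fun i => by
    rw [he i, Algebra.smul_def]
  exact ⟨fun i => by rw [he' i]; exact h.1 i, fun i => by rw [he' i]; exact h.2 i⟩

/-! ### §2 The expansion for generated elements -/

/-- **THE GROUP-RING EXPANSION.** With the data above (`hN`, `hD`, `hb`, `hw`, `he`, `hg`), for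
`X = (∏_i (e_i K_i + (1 − e_i))) B` and `Y d = (∏_{j∉d} N_j)(∏_{i∈d} (e_i M_i + (1 − e_i))) B`:
`(∏_i D_i)(X − Y univ) = Σ_{∅≠U} (∏_{i∈U} g_i)(∏_{i∉U} (D_i − g_i N_i))((∏_{i∈U} K_i − ∏_{i∈U} M_i) Y(univ∖U))`.
[folklore] -/
theorem prod_deriv_mul_sub_eq_sum_of_generated
    (hN : ∀ i, N i = ∑ h ∈ univ.filter (· ∈ H i), single h (1 : A))
    (hD : ∀ i, D i = ∑ j ∈ range (ν i), single (b i ^ j) ((j : ℕ) : A)) (hb : ∀ i, b i ∈ H i)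
    (hw : ∀ i, w i * (((univ.filter (· ∈ H i)).card : ℕ) : A) = 1) (he : ∀ i, e i = w i • N i)
    (hg : ∀ i, g i = (w i * (((∑ j ∈ range (ν i), j : ℕ)) : A)) • (1 : MonoidAlgebra A G))
    (hX : X = (∏ i, (e i * K i + (1 - e i))) * B)
    (hY : ∀ d : Finset ι, Y d = (∏ j ∈ univ \ d, N j) * (∏ i ∈ d, (e i * M i + (1 - e i))) * B) :
    (∏ i, D i) * (X - Y univ) =
      ∑ U ∈ (univ : Finset ι).powerset.erase ∅, (∏ i ∈ U, g i) *
        ((∏ i ∈ univ \ U, (D i - g i * N i)) * (((∏ i ∈ U, K i) - ∏ i ∈ U, M i) * Y (univ \ U))) := by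
  obtain ⟨he1, he2⟩ := proj_relations H w N e hN hw he
  -- the synthetic Kato family at all levels
  set X' : Finset ι → MonoidAlgebra A G :=
    fun d => (∏ j ∈ univ \ d, N j) * (∏ i ∈ d, (e i * K i + (1 - e i))) * B with hX'
  have hX'top : X' univ = X := by
    rw [hX]
    simp only [hX', Finset.sdiff_self, Finset.prod_empty, one_mul]
  have h := prod_deriv_mul_sub_eq_sum N D
    (fun i => (((univ.filter (· ∈ H i)).card : ℕ) : MonoidAlgebra A G))
    (fun i => (((∑ j ∈ range (ν i), j : ℕ)) : MonoidAlgebra A G)) g X' Y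
    (fun U _ => ∏ i ∈ U, K i) (fun U _ => ∏ i ∈ U, M i)
    (deriv_mul_norm_eq H b ν N D hN hD hb) (g_mul_card_eq H ν w g hw hg) (isUnit_card H w hw)
    (fun d => prod_sub_norm_mul_family_sub_eq_zero N e _ K M B X' Y he2 (by rw [hX']) (hY d))
    (fun d U hUd => prod_norm_mul_family_eq N e K B univ X' he1
      (fun d _ => by rw [hX']) hUd (Finset.subset_univ d))
    (fun d U hUd => prod_norm_mul_family_eq N e M B univ Y he1 (fun d _ => hY d) hUd
      (Finset.subset_univ d))
    univ
  rw [hX'top] at h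
  exact h

/-! ### §3 Reading the expansion integrally -/

omit [Fintype G] in
/-- **Integrality of the difference.** In a bigger coefficient picture `φ : R →+* S` (the application:
`ℤ₃[G] → ℚ₃[G]`) with an ideal `𝔞 ≤ R`: if the scalars `g_i`, the reduced derivatives `D̃_i` and the
lower pull-backs `Y d` are images of elements of `R`, and every Euler-factor difference
`∏_{i∈U} K_i − ∏_{i∈U} M_i` (`U ≠ ∅`) is the image of an element of `𝔞`, then the right-hand side of the
expansion lies in `φ(𝔞)`. [folklore] -/
theorem sum_mem_map_of_images {R S : Type*} [CommRing R] [CommRing S] (φ : R →+* S) (𝔞 : Ideal R)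
    (gS DS : ι → S) (KM YS : Finset ι → S)
    (hg : ∀ i, ∃ x : R, φ x = gS i) (hD : ∀ i, ∃ x : R, φ x = DS i)
    (hKM : ∀ U : Finset ι, U ≠ ∅ → ∃ x ∈ 𝔞, φ x = KM U) (hY : ∀ d : Finset ι, ∃ x : R, φ x = YS d) :
    ∑ U ∈ (univ : Finset ι).powerset.erase ∅, (∏ i ∈ U, gS i) *
        ((∏ i ∈ univ \ U, DS i) * (KM U * YS (univ \ U))) ∈
      (𝔞.toAddSubmonoid.map (φ : R →+ S) : AddSubmonoid S) := by
  refine sum_mem fun U hU => ?_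
  choose xg hxg using hg
  choose xD hxD using hD
  obtain ⟨xK, hxK𝔞, hxK⟩ := hKM U (Finset.ne_of_mem_erase hU)
  obtain ⟨xY, hxY⟩ := hY (univ \ U)
  have h1 : (∏ i ∈ U, gS i) = φ (∏ i ∈ U, xg i) := by rw [map_prod]; exact prod_congr rfl fun i _ => (hxg i).symm
  have h2 : (∏ i ∈ univ \ U, DS i) = φ (∏ i ∈ univ \ U, xD i) := by
    rw [map_prod]; exact prod_congr rfl fun i _ => (hxD i).symm
  rw [h1, h2, ← hxK, ← hxY]
  exact mul_mul_mem_map_of_mem φ 𝔞 _ _ _ _ hxK𝔞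

omit [Fintype ι] [DecidableEq ι] [Fintype G] in
/-- The Euler-factor difference along `U` from the local differences: if `K_i = φ(k_i)`, `M_i = φ(m_i)`
with `k_i − m_i ∈ 𝔞` for `i ∈ U`, then `∏_U K_i − ∏_U M_i = φ(x)` with `x ∈ 𝔞`. [folklore] -/
theorem exists_mem_map_eq_prod_sub_prod {R S : Type*} [CommRing R] [CommRing S] (φ : R →+* S)
    (𝔞 : Ideal R) (KS MS : ι → S) (k m : ι → R) (U : Finset ι) (hK : ∀ i ∈ U, φ (k i) = KS i)
    (hM : ∀ i ∈ U, φ (m i) = MS i) (hkm : ∀ i ∈ U, k i - m i ∈ 𝔞) :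
    ∃ x ∈ 𝔞, φ x = (∏ i ∈ U, KS i) - ∏ i ∈ U, MS i :=
  ⟨(∏ i ∈ U, k i) - ∏ i ∈ U, m i, prod_sub_prod_mem_of_sub_mem k m 𝔞 hkm, by
    rw [map_sub, map_prod, map_prod, prod_congr rfl hK, prod_congr rfl hM]⟩

end EulerFactorComparison

end Summit.BirchSwinnertonDyer.Rank1Residual.GaloisImage

end
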